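import Mathlib
import HarnessLib
import Summits.ValiantsHypothesis.ValiantsHypothesis.Theorems.LacunarySymmetroidMatrixDescartesOsculationCommutingDiagonal
import Summits.ValiantsHypothesis.ValiantsHypothesis.Theorems.LacunarySymmetroidMatrixDescartesOsculationLawUniformCongruence

/-!
# ValiantsHypothesis / LacunarySymmetroid — crux `MatrixDescartes` (stmt-ValiantsHypothesis-18050, V1),
# line `Cruxes/MatrixDescartes/Lines/osculation_law.lean` («osculation-law»): the COMMUTING / DIAGONAL column,
# part 3 — pairwise COMMUTING symmetric letters at the full-rank splitting `(m, 0)` (MATRIX layer; O1, desk RULING #295 (b))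

Writer val-port-4 g2 over val-lit-p5 g13's staged part-3 text; engine = p5's `OsculationCommuting.sheetProduct_count`
(p644367), diagonal column = `…OsculationCommutingDiagonal.lean :: osc_diagonal` (part 2).

* `exists_orthogonal_forall_isDiag` — simultaneous ORTHOGONAL diagonalisation of pairwise-commuting real symmetric
  matrices, in matrix clothes (Mathlib `LinearMap.IsSymmetric.directSum_isInternal_of_pairwise_commute`; only finitely
  many joint eigenspaces are `≠ ⊥`, `iSupIndep.fintypeNeBotOfFiniteDimensional`; `DirectSum.IsInternal.subordinateOrthonormalBasis`).
* `osc_commuting (m K d S)` — pairwise COMMUTING symmetric letters on `Fin m ⊕ Fin 0`: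
  `(osculationSet d S).Finite → ncard ≤ m·(C(K,2) − 1) + C(m,2)·(K − 1)` (line vocabulary unfolded verbatim), because
  `S_l = U D_l Uᵀ` (`Uᵀ U = 1`) makes the insertion polynomial LITERALLY that of the diagonal pencil `D`
  (`OsculationUniform.insertionPoly_inv_congr` with `Y = U`, `(det U)⁻² = 1`, `OsculationUniform.fromBlocks_one_fin_zero`),
  and `osc_diagonal` counts.

The roster statements in the LAW's literal shape (`osculationLawAt_diagonal`, `osculationLawAt_commuting_top`) are in the
companion `…OsculationCommuting.lean`.  HONEST LABEL: a RESTRICTED-CLASS column (commuting letters; polynomial); NOT the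
LAW `stub_osculationLaw`, not `MatrixDescartes` (stmt-18050), not Conjecture B; `VP ≠ VNP` is NOT proved.  No definitions,
no named facts; Mathlib + tree files by name.
-/

-- `Summit.ValiantsHypothesis.ValiantsHypothesis.…` is the tree's mandated single-conjunct layout (Sub = Summit).
set_option linter.dupNamespace false

noncomputable section

namespace Summit.ValiantsHypothesis.ValiantsHypothesis.Theorems.LacunarySymmetroidMatrixDescartes

namespace OsculationCommuting

open Polynomial WithLp
open scoped BigOperators Matrix InnerProductSpace

/-! ### Part 3 — pairwise COMMUTING symmetric letters at the full-rank splitting `(m, 0)` -/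

/-- **Simultaneous orthogonal diagonalisation** of a commuting family of real symmetric matrices (Mathlib's
`LinearMap.IsSymmetric.directSum_isInternal_of_pairwise_commute` + a subordinate orthonormal basis, in matrix
clothes): there is `U` with `Uᵀ U = 1 = U Uᵀ` and every `Uᵀ S_l U` diagonal. [folklore] -/
theorem exists_orthogonal_forall_isDiag {n : Type*} [Fintype n] [DecidableEq n] {K : ℕ} (S : Fin K → Matrix n n ℝ)
    (hS : ∀ l, (S l).IsSymm) (hcomm : ∀ k l, S k * S l = S l * S k) :
    ∃ U : Matrix n n ℝ, Uᵀ * U = 1 ∧ U * Uᵀ = 1 ∧ ∀ l, (Uᵀ * S l * U).IsDiag := by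
  classical
  -- the operators
  set T : Fin K → Module.End ℝ (EuclideanSpace ℝ n) := fun l => Matrix.toEuclideanLin (S l) with hTdef
  have hT : ∀ l, (T l).IsSymmetric := by
    intro l
    have hH : (S l).IsHermitian := by
      unfold Matrix.IsHermitian
      rw [Matrix.conjTranspose_eq_transpose_of_trivial]
      exact hS l
    exact Matrix.isSymmetric_toEuclideanLin_iff.2 hH
  have hC : Pairwise (Function.onFun Commute T) := by
    intro k l _
    change T k * T l = T l * T k
    rw [Module.End.mul_eq_comp, Module.End.mul_eq_comp, hTdef]
    dsimp only
    rw [← Matrix.toLpLin_mul_same, ← Matrix.toLpLin_mul_same, hcomm]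
  -- joint eigenspaces: finitely many non-trivial ones, pairwise orthogonal, spanning
  set V : (Fin K → ℝ) → Submodule ℝ (EuclideanSpace ℝ n) := fun α => ⨅ j, Module.End.eigenspace (T j) (α j)
    with hVdef
  have hV0 : DirectSum.IsInternal V := LinearMap.IsSymmetric.directSum_isInternal_of_pairwise_commute hT hC
  letI : Fintype {α // V α ≠ ⊥} := hV0.submodule_iSupIndep.fintypeNeBotOfFiniteDimensional
  have hV : DirectSum.IsInternal (fun α : {α // V α ≠ ⊥} => V α) := DirectSum.isInternal_ne_bot_iff.2 hV0
  have hV' : OrthogonalFamily ℝ (fun α : {α // V α ≠ ⊥} => V α) fun α => (V α.1).subtypeₗᵢ :=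
    (LinearMap.IsSymmetric.orthogonalFamily_iInf_eigenspaces hT).comp Subtype.val_injective
  have hn : Module.finrank ℝ (EuclideanSpace ℝ n) = Fintype.card n := finrank_euclideanSpace
  set b := hV.subordinateOrthonormalBasis hn hV' with hbdef
  set μ : Fin (Fintype.card n) → Fin K → ℝ := fun a => (hV.subordinateOrthonormalBasisIndex hn a hV').1 with hμ
  have hb : ∀ a l, T l (b a) = μ a l • b a := by
    intro a l
    have h := hV.subordinateOrthonormalBasis_subordinate hn a hV'
    change b a ∈ ⨅ j, Module.End.eigenspace (T j) ((hV.subordinateOrthonormalBasisIndex hn a hV').1 j) at h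
    exact Module.End.mem_eigenspace_iff.1 ((Submodule.mem_iInf _).1 h l)
  -- in coordinates
  have hbS : ∀ a l, S l *ᵥ ofLp (b a) = μ a l • ofLp (b a) := by
    intro a l
    have h := congrArg ofLp (hb a l)
    rwa [hTdef, Matrix.ofLp_toLpLin, Matrix.toLin'_apply, WithLp.ofLp_smul] at h
  have hinner0 : ∀ a a', ∑ i, ofLp (b a) i * ofLp (b a') i = if a = a' then 1 else 0 := by
    intro a a'
    have h := b.inner_eq_ite a a'
    rw [EuclideanSpace.inner_eq_star_dotProduct, star_trivial, dotProduct] at h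
    rw [← h]
    exact Finset.sum_congr rfl fun i _ => mul_comm _ _
  -- matrix clothes
  set e : n ≃ Fin (Fintype.card n) := Fintype.equivFin n with he
  set U : Matrix n n ℝ := Matrix.of fun i k => ofLp (b (e k)) i with hU
  have hUik : ∀ i k, U i k = ofLp (b (e k)) i := fun i k => rfl
  have hinner : ∀ k k' : n, ∑ i, U i k * U i k' = if k = k' then 1 else 0 := by
    intro k k'
    simp only [hUik, hinner0, EmbeddingLike.apply_eq_iff_eq]
  have hUU : Uᵀ * U = 1 := by
    ext k k'
    rw [Matrix.mul_apply, Matrix.one_apply]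
    simpa only [Matrix.transpose_apply] using hinner k k'
  refine ⟨U, hUU, mul_eq_one_comm.1 hUU, fun l => ?_⟩
  intro k k' hkk'
  have hSU : ∀ i, (S l * U) i k' = μ (e k') l * U i k' := by
    intro i
    have h1 : (S l * U) i k' = (S l *ᵥ ofLp (b (e k'))) i := rfl
    rw [h1, hbS, Pi.smul_apply, smul_eq_mul, hUik]
  rw [Matrix.mul_assoc, Matrix.mul_apply]
  simp only [Matrix.transpose_apply, hSU]
  calc ∑ i, U i k * (μ (e k') l * U i k') = μ (e k') l * ∑ i, U i k * U i k' := by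
        rw [Finset.mul_sum]; exact Finset.sum_congr rfl fun i _ => by ring
    _ = 0 := by rw [hinner, if_neg hkk', mul_zero]

set_option maxHeartbeats 800000 in
/-- **The COMMUTING column** (NOTE-p7g13 §11 (2), kernel form).  For pairwise COMMUTING real symmetric letters
`S l` on `Fin m ⊕ Fin 0` (the full-rank splitting of ROUTE′: the inserted letter is the identity) and any exponents
`d`, if the line's osculation set (vocabulary of `Cruxes/MatrixDescartes/Lines/osculation_law.lean` unfolded verbatim)
is finite then `#osc ≤ m·(C(K,2) − 1) + C(m,2)·(K − 1)` — POLYNOMIAL in `(m, K)`.  Simultaneous orthogonal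
diagonalisation `S_l = U D_l Uᵀ` makes the insertion polynomial LITERALLY that of the diagonal pencil `D`
(`OsculationUniform.insertionPoly_inv_congr` with `Y = U`, `det U = ±1`), and `osc_diagonal` counts.  HONEST LABEL:
a restricted-class column, not the LAW `stub_osculationLaw`. [folklore] -/
theorem osc_commuting (m K : ℕ) (d : Fin K → ℕ) (S : Fin K → Matrix (Fin m ⊕ Fin 0) (Fin m ⊕ Fin 0) ℝ)
    (hS : ∀ l, (S l).IsSymm) (hcomm : ∀ k l, S k * S l = S l * S k)
    (hfin : {p : Fin 2 → ℝ | 0 < p 0 ∧ 0 < p 1 ∧ MvPolynomial.eval p (∑ l, (MvPolynomial.X (0 : Fin 2) : MvPolynomial (Fin 2) ℝ) ^ d l •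
              (S l).map (MvPolynomial.C : ℝ →+* MvPolynomial (Fin 2) ℝ)
            + (MvPolynomial.X (1 : Fin 2) : MvPolynomial (Fin 2) ℝ) •
              (Matrix.fromBlocks 1 0 0 0 : Matrix (Fin m ⊕ Fin 0) (Fin m ⊕ Fin 0) ℝ).map
                (MvPolynomial.C : ℝ →+* MvPolynomial (Fin 2) ℝ)).det = 0 ∧
      MvPolynomial.eval p
        (MvPolynomial.X 0 * MvPolynomial.pderiv 0 (MvPolynomial.X 0 * MvPolynomial.pderiv 0 ((∑ l, (MvPolynomial.X (0 : Fin 2) : MvPolynomial (Fin 2) ℝ) ^ d l •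
              (S l).map (MvPolynomial.C : ℝ →+* MvPolynomial (Fin 2) ℝ)
            + (MvPolynomial.X (1 : Fin 2) : MvPolynomial (Fin 2) ℝ) •
              (Matrix.fromBlocks 1 0 0 0 : Matrix (Fin m ⊕ Fin 0) (Fin m ⊕ Fin 0) ℝ).map
                (MvPolynomial.C : ℝ →+* MvPolynomial (Fin 2) ℝ)).det)) * (MvPolynomial.X 1 * MvPolynomial.pderiv 1 ((∑ l, (MvPolynomial.X (0 : Fin 2) : MvPolynomial (Fin 2) ℝ) ^ d l •
              (S l).map (MvPolynomial.C : ℝ →+* MvPolynomial (Fin 2) ℝ)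
            + (MvPolynomial.X (1 : Fin 2) : MvPolynomial (Fin 2) ℝ) •
              (Matrix.fromBlocks 1 0 0 0 : Matrix (Fin m ⊕ Fin 0) (Fin m ⊕ Fin 0) ℝ).map
                (MvPolynomial.C : ℝ →+* MvPolynomial (Fin 2) ℝ)).det)) ^ 2
          - 2 * (MvPolynomial.X 0 * MvPolynomial.pderiv 0 (MvPolynomial.X 1 * MvPolynomial.pderiv 1 ((∑ l, (MvPolynomial.X (0 : Fin 2) : MvPolynomial (Fin 2) ℝ) ^ d l •
              (S l).map (MvPolynomial.C : ℝ →+* MvPolynomial (Fin 2) ℝ)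
            + (MvPolynomial.X (1 : Fin 2) : MvPolynomial (Fin 2) ℝ) •
              (Matrix.fromBlocks 1 0 0 0 : Matrix (Fin m ⊕ Fin 0) (Fin m ⊕ Fin 0) ℝ).map
                (MvPolynomial.C : ℝ →+* MvPolynomial (Fin 2) ℝ)).det)))
            * (MvPolynomial.X 0 * MvPolynomial.pderiv 0 ((∑ l, (MvPolynomial.X (0 : Fin 2) : MvPolynomial (Fin 2) ℝ) ^ d l •
              (S l).map (MvPolynomial.C : ℝ →+* MvPolynomial (Fin 2) ℝ)
            + (MvPolynomial.X (1 : Fin 2) : MvPolynomial (Fin 2) ℝ) •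
              (Matrix.fromBlocks 1 0 0 0 : Matrix (Fin m ⊕ Fin 0) (Fin m ⊕ Fin 0) ℝ).map
                (MvPolynomial.C : ℝ →+* MvPolynomial (Fin 2) ℝ)).det)) * (MvPolynomial.X 1 * MvPolynomial.pderiv 1 ((∑ l, (MvPolynomial.X (0 : Fin 2) : MvPolynomial (Fin 2) ℝ) ^ d l •
              (S l).map (MvPolynomial.C : ℝ →+* MvPolynomial (Fin 2) ℝ)
            + (MvPolynomial.X (1 : Fin 2) : MvPolynomial (Fin 2) ℝ) •
              (Matrix.fromBlocks 1 0 0 0 : Matrix (Fin m ⊕ Fin 0) (Fin m ⊕ Fin 0) ℝ).map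
                (MvPolynomial.C : ℝ →+* MvPolynomial (Fin 2) ℝ)).det))
          + MvPolynomial.X 1 * MvPolynomial.pderiv 1 (MvPolynomial.X 1 * MvPolynomial.pderiv 1 ((∑ l, (MvPolynomial.X (0 : Fin 2) : MvPolynomial (Fin 2) ℝ) ^ d l •
              (S l).map (MvPolynomial.C : ℝ →+* MvPolynomial (Fin 2) ℝ)
            + (MvPolynomial.X (1 : Fin 2) : MvPolynomial (Fin 2) ℝ) •
              (Matrix.fromBlocks 1 0 0 0 : Matrix (Fin m ⊕ Fin 0) (Fin m ⊕ Fin 0) ℝ).map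
                (MvPolynomial.C : ℝ →+* MvPolynomial (Fin 2) ℝ)).det)) * (MvPolynomial.X 0 * MvPolynomial.pderiv 0 ((∑ l, (MvPolynomial.X (0 : Fin 2) : MvPolynomial (Fin 2) ℝ) ^ d l •
              (S l).map (MvPolynomial.C : ℝ →+* MvPolynomial (Fin 2) ℝ)
            + (MvPolynomial.X (1 : Fin 2) : MvPolynomial (Fin 2) ℝ) •
              (Matrix.fromBlocks 1 0 0 0 : Matrix (Fin m ⊕ Fin 0) (Fin m ⊕ Fin 0) ℝ).map
                (MvPolynomial.C : ℝ →+* MvPolynomial (Fin 2) ℝ)).det)) ^ 2) = 0}.Finite) :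
    {p : Fin 2 → ℝ | 0 < p 0 ∧ 0 < p 1 ∧ MvPolynomial.eval p (∑ l, (MvPolynomial.X (0 : Fin 2) : MvPolynomial (Fin 2) ℝ) ^ d l •
              (S l).map (MvPolynomial.C : ℝ →+* MvPolynomial (Fin 2) ℝ)
            + (MvPolynomial.X (1 : Fin 2) : MvPolynomial (Fin 2) ℝ) •
              (Matrix.fromBlocks 1 0 0 0 : Matrix (Fin m ⊕ Fin 0) (Fin m ⊕ Fin 0) ℝ).map
                (MvPolynomial.C : ℝ →+* MvPolynomial (Fin 2) ℝ)).det = 0 ∧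
      MvPolynomial.eval p
        (MvPolynomial.X 0 * MvPolynomial.pderiv 0 (MvPolynomial.X 0 * MvPolynomial.pderiv 0 ((∑ l, (MvPolynomial.X (0 : Fin 2) : MvPolynomial (Fin 2) ℝ) ^ d l •
              (S l).map (MvPolynomial.C : ℝ →+* MvPolynomial (Fin 2) ℝ)
            + (MvPolynomial.X (1 : Fin 2) : MvPolynomial (Fin 2) ℝ) •
              (Matrix.fromBlocks 1 0 0 0 : Matrix (Fin m ⊕ Fin 0) (Fin m ⊕ Fin 0) ℝ).map
                (MvPolynomial.C : ℝ →+* MvPolynomial (Fin 2) ℝ)).det)) * (MvPolynomial.X 1 * MvPolynomial.pderiv 1 ((∑ l, (MvPolynomial.X (0 : Fin 2) : MvPolynomial (Fin 2) ℝ) ^ d l •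
              (S l).map (MvPolynomial.C : ℝ →+* MvPolynomial (Fin 2) ℝ)
            + (MvPolynomial.X (1 : Fin 2) : MvPolynomial (Fin 2) ℝ) •
              (Matrix.fromBlocks 1 0 0 0 : Matrix (Fin m ⊕ Fin 0) (Fin m ⊕ Fin 0) ℝ).map
                (MvPolynomial.C : ℝ →+* MvPolynomial (Fin 2) ℝ)).det)) ^ 2
          - 2 * (MvPolynomial.X 0 * MvPolynomial.pderiv 0 (MvPolynomial.X 1 * MvPolynomial.pderiv 1 ((∑ l, (MvPolynomial.X (0 : Fin 2) : MvPolynomial (Fin 2) ℝ) ^ d l •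
              (S l).map (MvPolynomial.C : ℝ →+* MvPolynomial (Fin 2) ℝ)
            + (MvPolynomial.X (1 : Fin 2) : MvPolynomial (Fin 2) ℝ) •
              (Matrix.fromBlocks 1 0 0 0 : Matrix (Fin m ⊕ Fin 0) (Fin m ⊕ Fin 0) ℝ).map
                (MvPolynomial.C : ℝ →+* MvPolynomial (Fin 2) ℝ)).det)))
            * (MvPolynomial.X 0 * MvPolynomial.pderiv 0 ((∑ l, (MvPolynomial.X (0 : Fin 2) : MvPolynomial (Fin 2) ℝ) ^ d l •
              (S l).map (MvPolynomial.C : ℝ →+* MvPolynomial (Fin 2) ℝ)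
            + (MvPolynomial.X (1 : Fin 2) : MvPolynomial (Fin 2) ℝ) •
              (Matrix.fromBlocks 1 0 0 0 : Matrix (Fin m ⊕ Fin 0) (Fin m ⊕ Fin 0) ℝ).map
                (MvPolynomial.C : ℝ →+* MvPolynomial (Fin 2) ℝ)).det)) * (MvPolynomial.X 1 * MvPolynomial.pderiv 1 ((∑ l, (MvPolynomial.X (0 : Fin 2) : MvPolynomial (Fin 2) ℝ) ^ d l •
              (S l).map (MvPolynomial.C : ℝ →+* MvPolynomial (Fin 2) ℝ)
            + (MvPolynomial.X (1 : Fin 2) : MvPolynomial (Fin 2) ℝ) •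
              (Matrix.fromBlocks 1 0 0 0 : Matrix (Fin m ⊕ Fin 0) (Fin m ⊕ Fin 0) ℝ).map
                (MvPolynomial.C : ℝ →+* MvPolynomial (Fin 2) ℝ)).det))
          + MvPolynomial.X 1 * MvPolynomial.pderiv 1 (MvPolynomial.X 1 * MvPolynomial.pderiv 1 ((∑ l, (MvPolynomial.X (0 : Fin 2) : MvPolynomial (Fin 2) ℝ) ^ d l •
              (S l).map (MvPolynomial.C : ℝ →+* MvPolynomial (Fin 2) ℝ)
            + (MvPolynomial.X (1 : Fin 2) : MvPolynomial (Fin 2) ℝ) •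
              (Matrix.fromBlocks 1 0 0 0 : Matrix (Fin m ⊕ Fin 0) (Fin m ⊕ Fin 0) ℝ).map
                (MvPolynomial.C : ℝ →+* MvPolynomial (Fin 2) ℝ)).det)) * (MvPolynomial.X 0 * MvPolynomial.pderiv 0 ((∑ l, (MvPolynomial.X (0 : Fin 2) : MvPolynomial (Fin 2) ℝ) ^ d l •
              (S l).map (MvPolynomial.C : ℝ →+* MvPolynomial (Fin 2) ℝ)
            + (MvPolynomial.X (1 : Fin 2) : MvPolynomial (Fin 2) ℝ) •
              (Matrix.fromBlocks 1 0 0 0 : Matrix (Fin m ⊕ Fin 0) (Fin m ⊕ Fin 0) ℝ).map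
                (MvPolynomial.C : ℝ →+* MvPolynomial (Fin 2) ℝ)).det)) ^ 2) = 0}.ncard ≤
      m * (K.choose 2 - 1) + m.choose 2 * (K - 1) := by
  classical
  obtain ⟨U, hUU, hUU', hdiag⟩ := exists_orthogonal_forall_isDiag S hS hcomm
  set D : Fin K → Matrix (Fin m ⊕ Fin 0) (Fin m ⊕ Fin 0) ℝ := fun l => Uᵀ * S l * U with hD
  have hdetU : U.det ≠ 0 := by
    intro h
    have h1 := congrArg Matrix.det hUU
    rw [Matrix.det_mul, Matrix.det_transpose, h, mul_zero, Matrix.det_one] at h1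
    exact zero_ne_one h1
  have hUinv : U⁻¹ = Uᵀ := Matrix.inv_eq_right_inv hUU'
  -- the letters are congruent to the diagonal ones: `S l = (U⁻¹)ᵀ D l U⁻¹`
  have hS' : S = fun l => (U⁻¹)ᵀ * D l * U⁻¹ := by
    funext l
    rw [hUinv, Matrix.transpose_transpose, hD]
    simp only [← Matrix.mul_assoc, hUU', Matrix.one_mul]
    rw [Matrix.mul_assoc, hUU', Matrix.mul_one]
  -- hence the SAME insertion polynomial
  have hdet2 : (U.det)⁻¹ ^ 2 = 1 := by
    have h1 := congrArg Matrix.det hUU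
    rw [Matrix.det_mul, Matrix.det_transpose, Matrix.det_one] at h1
    rw [inv_pow, sq, h1, inv_one]
  have hpoly : (∑ l, (MvPolynomial.X (0 : Fin 2) : MvPolynomial (Fin 2) ℝ) ^ d l •
              (S l).map (MvPolynomial.C : ℝ →+* MvPolynomial (Fin 2) ℝ)
            + (MvPolynomial.X (1 : Fin 2) : MvPolynomial (Fin 2) ℝ) •
              (Matrix.fromBlocks 1 0 0 0 : Matrix (Fin m ⊕ Fin 0) (Fin m ⊕ Fin 0) ℝ).map
                (MvPolynomial.C : ℝ →+* MvPolynomial (Fin 2) ℝ)).det = (∑ l, (MvPolynomial.X (0 : Fin 2) : MvPolynomial (Fin 2) ℝ) ^ d l •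
              (D l).map (MvPolynomial.C : ℝ →+* MvPolynomial (Fin 2) ℝ)
            + (MvPolynomial.X (1 : Fin 2) : MvPolynomial (Fin 2) ℝ) •
              (Matrix.fromBlocks 1 0 0 0 : Matrix (Fin m ⊕ Fin 0) (Fin m ⊕ Fin 0) ℝ).map
                (MvPolynomial.C : ℝ →+* MvPolynomial (Fin 2) ℝ)).det := by
    rw [hS', OsculationUniform.insertionPoly_inv_congr m U hdetU d D, hdet2, map_one, one_mul, hUU,
      OsculationUniform.fromBlocks_one_fin_zero]
  rw [hpoly] at hfin ⊢
  exact osc_diagonal m 0 K d D (fun l => hdiag l) hfin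


end OsculationCommuting

end Summit.ValiantsHypothesis.ValiantsHypothesis.Theorems.LacunarySymmetroidMatrixDescartes

end
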